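import Summits.BirchSwinnertonDyer.BirchSwinnertonDyer.Theorems.TwistFamilyManinDescentRaynaudRegimeOfKummerFreeEngine
import Summits.BirchSwinnertonDyer.BirchSwinnertonDyer.Theorems.ManinLocalTwoThreeManinPrimeToAdditiveFiveLeAcrossIsogenyOfStrongIsUnstarred
import Literature.NumberTheory.EllipticCurves.ManinConstantConductorLe300000
import HarnessLib

/-!
# Route `TwistFamilyManinDescent`, crux Ray57 `EisensteinRaynaudRegimeManinUnit` (stmt-BirchSwinnertonDyer-26325):
# the item graph of the Raynaud-regime node BY NAME — 27071 ⟸ 26325, 27296 ⟺ 27072 (given BCDT),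
# 26325 ⟺ 27071 (given the engine), Ray57 ⟸ Cremona ∧ K15b ∧ «no STARRED optimal curve beyond 5·10⁵», and
# S16b / Ray57 ⟸ the sibling cell's ONE orientation conjecture E-imc-5 at 5, 7 (∧ K15b)

Leafhand seat `leafhand-bsd-twistfamilymaninde-2` g0 (prover, one generation) on the registered skeleton
`Cruxes/EisensteinRaynaudRegimeManinUnit/Lines/kummer_free_split.lean` (4f857ef25131; open stubs
`stub_unstarredManinUnit` = K15b `SupersingularUnstarredStrongManinUnit` stmt-27071 and `stub_kummerFreeEngine` = S16b
`SupersingularKummerFreeStrongIsUnstarred` stmt-27296). THEOREMS ONLY (no definition, no named fact, no `sorry`);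
`--supports stmt-BirchSwinnertonDyer-26325`, helper; NOTHING is closed by this file; BSD is not proved; Manin's conjecture is
not proved. Both stubs are beyond print (K15b: Edixhoven's thesis Thm 4.6.3 / Lemma 4.6.4 are printed for `p > 7`; S16b:
a Stevens-type orientation law) and stay OPEN. What this file records, kernel-checked, is the exact logical position of the
four open items of the node, so that the planner can merge them and a later proof of any one is booked against the others:

* §1 `supersingularKummerFreeStrongIsUnstarred_of_supersingularStrongIsUnstarred` — **S16b ⟸ K15a** (the engine statement
  carries one MORE hypothesis, Kummer-freeness, than K15a `SupersingularStrongIsUnstarred` stmt-27072); with the landed cone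
  (G16 `strongIsUnstarredOfKummerFree_proof` p624309 fed with the PROVED S16a p624109) this gives
  `supersingularKummerFreeStrongIsUnstarred_iff` — **27296 ⟺ 27072 given modularity** (`exists_isNewformOf`).
* §2 `supersingularUnstarredStrongManinUnit_of_eisensteinRaynaudRegimeManinUnit` — **K15b ⟸ Ray57** (K15b is Ray57 on the
  sub-rows `(5; v₅Δ = 4)`, `(7; v₇Δ = 3)`), hence `eisensteinRaynaudRegimeManinUnit_iff_of_strongIsUnstarred` — **26325 ⟺ 27071
  given K15a** (G15 `raynaudRegimeOfOrientation_proof`) — and `eisensteinRaynaudRegimeManinUnit_iff_of_kummerFreeEngine` —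
  **26325 ⟺ 27071 given S16b** (the registered skeleton's own composition p624854). In particular any proof of the crux
  (by whatever road) closes 27071 by name through §2.
* §3 `eisensteinRaynaudRegimeManinUnit_of_cremona_of_unstarred_of_noStarredOptimalBeyondRange` — **what the orientation input
  must actually deliver for THIS crux**: Ray57 ⟸ Cremona's certified range (`cremona_abs_maninConstant_eq_one_of_level_le_500000`,
  cite-only named fact: `|c| = 1` for every lattice-optimal datum at level `≤ 5·10⁵`) ∧ K15b ∧ the EMPTINESS of the two
  starred Kodaira cells `(5; IV*, v₅Δ_min = 8)`, `(7; III*, v₇Δ_min = 9)` for lattice-optimal curves with `E[p]` reducible,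
  `p² ∣ N`, `p*`-twist additive and `N > 5·10⁵` (displayed hypothesis `hVac`, the large-conductor restriction of K15a to the
  rows where G15 uses it; certified empty for `N ≤ 5·10⁵` by the route's instrument I6, 0/947). CONDITIONAL on the Cremona
  fact and on the two displayed open statements.
* §4 `supersingularKummerFreeStrongIsUnstarred_of_acrossIsogeny`, `eisensteinRaynaudRegimeManinUnit_of_acrossIsogeny_of_unstarredStrongManinUnit`
  — **the registered stub `stub_kummerFreeEngine` (S16b) and the crux, BY NAME, from the sibling cell bsd-f2-manin's ONE
  registered orientation conjecture E-imc-5 `Rank1Residual.ManinAdditive.OptimalUnstarredAcrossIsogeny` at `5` and `7`**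
  (route ManinLocalTwoThree's width-seat theorem `supersingularStrongIsUnstarred_of_acrossIsogeny`, p635512: K15a ⟸ modularity ∧
  E-imc-5(5) ∧ E-imc-5(7), Coates' congruence, no Gealy–Klagsbrun) composed with §1 and G15: S16b ⟸ modularity ∧ E-imc-5(5,7);
  Ray57 ⟸ E-imc-5(5,7) ∧ K15b. So on this node the two routes' books carry ONE open orientation law, not three (S16b, K15a, E-imc-5).
  CONDITIONAL on E-imc-5 (OPEN conjecture of the sibling cell, not in print) and K15b.

STATUS OF RECORD for the item (not re-derived here): the crux 26325 and K15b 27071 are ALSO landed BY NAME modulo ONE printed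
fact, the Calegari–Dimitrov–Tang unbounded-denominators theorem (`TwistFamilyManinDescentOfCDT.eisensteinRaynaudRegimeManinUnit_of_CDT`,
`…supersingularUnstarredStrongManinUnit_of_CDT`, tree file `Theorems/TwistFamilyManinDescentCellsOfCDT.lean`, p770019); S16b / K15a / E-imc-5
(orientation, no Manin constant in the statement) are NOT reached by that road.

References: [EdixhovenManin1991] B. Edixhoven, in *Arithmetic Algebraic Geometry* (Texel 1989), Progr. Math. 89 (1991),
Thm. 3, Prop. 7; [Stevens1989] G. Stevens, Invent. Math. 98 (1989), §2; [CesnaviciusNeururerSaha2023] §1 p. 2 (Cremona's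
range); [Cremona2022ManinConstants]; [DiamondShurman2005] Thm. 8.8.1. Design: theorems only; axioms `propext`,
`Classical.choice`, `Quot.sound`.
-/

set_option autoImplicit false
-- the Theorems directory repeats the summit name (sibling precedent `TwistFamilyManinDescentRaynaudRegimeOfOrientation.lean`)
set_option linter.dupNamespace false

noncomputable section

namespace Summit.BirchSwinnertonDyer.BirchSwinnertonDyer.Theorems.TwistFamilyManinDescent

open Summit.BirchSwinnertonDyer.BirchSwinnertonDyer.Theses.TwistFamilyManinDescent
open Literature.NumberTheory.EllipticCurves Literature.NumberTheory.EllipticCurves.ModularForms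

/-! ## §1 The engine S16b (stmt-27296) and K15a (stmt-27072) are one statement given modularity -/

/-- **S16b ⟸ K15a.** `SupersingularKummerFreeStrongIsUnstarred` (stmt-27296) is `SupersingularStrongIsUnstarred`
(stmt-27072) with one extra hypothesis (no `ℚ_p`-rational `p`-torsion anywhere in the `ℚ`-isogeny class), so K15a implies it
outright. Propositional; closes nothing. [cite: Stevens1989, §2] -/
theorem supersingularKummerFreeStrongIsUnstarred_of_supersingularStrongIsUnstarred
    (hK15a : SupersingularStrongIsUnstarred) : SupersingularKummerFreeStrongIsUnstarred := by
  intro W _ _ N _ D p hp hrow hpN hred htw _hKummer hopt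
  exact hK15a W D p hp.out hrow hpN hred htw hopt

/-- **27296 ⟺ 27072 given modularity.** With `exists_isNewformOf` (BCDT 2001 / Diamond–Shurman Thm. 8.8.1, a hypothesis)
the engine S16b and K15a are EQUIVALENT: (⇒) is the landed glue G16 `strongIsUnstarredOfKummerFree_proof` fed with the proved
local lever S16a `raynaudRegimeClassNoLocalPTorsion_proof` (packaged as
`supersingularStrongIsUnstarred_of_modularity_of_kummerFreeEngine`, p624854); (⇐) is §1's first theorem. CONDITIONAL on
modularity (displayed); closes nothing. [cite: DiamondShurman2005, Thm. 8.8.1] [cite: Stevens1989, §2] -/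
theorem supersingularKummerFreeStrongIsUnstarred_iff
    (hmod : Literature.NumberTheory.EllipticCurves.ModularForms.exists_isNewformOf) :
    SupersingularKummerFreeStrongIsUnstarred ↔ SupersingularStrongIsUnstarred :=
  ⟨supersingularStrongIsUnstarred_of_modularity_of_kummerFreeEngine hmod,
    supersingularKummerFreeStrongIsUnstarred_of_supersingularStrongIsUnstarred⟩

/-! ## §2 K15b (stmt-27071) is the crux on its unstarred rows: 27071 ⟸ 26325, and the two are one item given K15a or S16b -/

/-- **K15b ⟸ Ray57.** `SupersingularUnstarredStrongManinUnit` (stmt-27071) is `EisensteinRaynaudRegimeManinUnit`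
(stmt-26325) restricted to the rows `(5; v₅Δ_min = 4)`, `(7; v₇Δ_min = 3)` of the row predicate
`(5; v₅Δ_min ∈ {4,8}) ∨ (7; v₇Δ_min ∈ {3,9})`; so the crux implies it outright, and any proof of 26325 closes 27071 by name.
Propositional; closes nothing. [cite: EdixhovenManin1991, Thm. 3 and Prop. 7] -/
theorem supersingularUnstarredStrongManinUnit_of_eisensteinRaynaudRegimeManinUnit
    (hRay : EisensteinRaynaudRegimeManinUnit) : SupersingularUnstarredStrongManinUnit := by
  intro h₁ h₂ h₃ h₄ W _ _ N _ D p hp hrow hpN hred htw hopt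
  refine hRay h₁ h₂ h₃ h₄ W D p hp ?_ hpN hred htw hopt
  rcases hrow with ⟨rfl, h⟩ | ⟨rfl, h⟩
  · exact Or.inl ⟨rfl, by simp only [h, Finset.mem_insert, Finset.mem_singleton]; decide⟩
  · exact Or.inr ⟨rfl, by simp only [h, Finset.mem_insert, Finset.mem_singleton]; decide⟩

/-- **26325 ⟺ 27071 given K15a.** Under `SupersingularStrongIsUnstarred` (stmt-27072, displayed hypothesis) the crux Ray57
and K15b are EQUIVALENT: (⇐) is the landed glue G15 `raynaudRegimeOfOrientation_proof` (stmt-27096), (⇒) is §2's first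
theorem. CONDITIONAL on K15a; closes nothing. [cite: EdixhovenManin1991, Thm. 3 and Prop. 7] -/
theorem eisensteinRaynaudRegimeManinUnit_iff_of_strongIsUnstarred (hK15a : SupersingularStrongIsUnstarred) :
    EisensteinRaynaudRegimeManinUnit ↔ SupersingularUnstarredStrongManinUnit :=
  ⟨supersingularUnstarredStrongManinUnit_of_eisensteinRaynaudRegimeManinUnit,
    raynaudRegimeOfOrientation_proof hK15a⟩

/-- **26325 ⟺ 27071 given the engine S16b** — the registered skeleton `kummer_free_split` read as an equivalence: under
`SupersingularKummerFreeStrongIsUnstarred` (stmt-27296, displayed hypothesis; modularity is Ray57's own fourth antecedent,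
consumed inside the cone `eisensteinRaynaudRegimeManinUnit_of_kummerFreeEngine_of_unstarredStrongManinUnit`, p624854) the
crux and its other stub K15b are EQUIVALENT. CONDITIONAL on S16b; closes nothing.
[cite: EdixhovenManin1991, Thm. 3 and Prop. 7] [cite: Stevens1989, §2] -/
theorem eisensteinRaynaudRegimeManinUnit_iff_of_kummerFreeEngine (h16b : SupersingularKummerFreeStrongIsUnstarred) :
    EisensteinRaynaudRegimeManinUnit ↔ SupersingularUnstarredStrongManinUnit :=
  ⟨supersingularUnstarredStrongManinUnit_of_eisensteinRaynaudRegimeManinUnit,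
    eisensteinRaynaudRegimeManinUnit_of_kummerFreeEngine_of_unstarredStrongManinUnit h16b⟩

/-! ## §3 What the orientation input must deliver for the crux: emptiness of two starred cells beyond Cremona's range -/

/-- **Ray57 ⟸ Cremona's certified range ∧ K15b ∧ «no STARRED lattice-optimal curve on the Raynaud rows beyond `N = 5·10⁵`».**
`hCr` is the cite-only named fact `cremona_abs_maninConstant_eq_one_of_level_le_500000` (`|c| = 1` for every lattice-optimal
datum of a globally minimal curve at level `≤ 500000`); `hK15b` is the open stub K15b (stmt-27071); `hVac` is the
large-conductor restriction of K15a (stmt-27072) to the two cells where the glue G15 actually invokes it: NO globally minimal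
`W` with `(p; v_pΔ_min) ∈ {(5; 8), (7; 9)}` (Kodaira IV* at `5`, III* at `7`), `p² ∣ N`, `E[p]` reducible, `W ⊗ p*` neither
good nor multiplicative at `p`, carries a lattice-optimal `X₀(N)`-datum at a level `N > 500000` (for `N ≤ 500000` the cells
are certified empty by the route's instrument I6, 0/947, and are in any case settled by `hCr`). Proof: levels `≤ 5·10⁵` by
`not_dvd_maninConstant_of_level_le_500000`; beyond, dispatch on the row predicate — unstarred rows are K15b verbatim, starred
rows are empty by `hVac`. CONDITIONAL on the Cremona fact and the two displayed open statements; closes nothing; BSD and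
Manin's conjecture are not proved by this. [cite: CesnaviciusNeururerSaha2023, §1 p. 2] [cite: Cremona2022ManinConstants]
[cite: EdixhovenManin1991, Thm. 3 and Prop. 7] -/
theorem eisensteinRaynaudRegimeManinUnit_of_cremona_of_unstarred_of_noStarredOptimalBeyondRange
    (hCr : cremona_abs_maninConstant_eq_one_of_level_le_500000)
    (hK15b : SupersingularUnstarredStrongManinUnit)
    (hVac : ∀ (W : WeierstrassCurve ℚ) [W.IsElliptic] [W.IsGloballyMinimal] {N : ℕ} [NeZero N]
      (D : ModularParametrizationData W N) (p : ℕ) (hp : p.Prime),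
      ((p = 5 ∧ padicValInt 5 W.minimalDiscriminantInt = 8) ∨ (p = 7 ∧ padicValInt 7 W.minimalDiscriminantInt = 9)) →
      p ^ 2 ∣ N → ¬ W.HasIrreducibleModPGaloisRep p →
      ¬ ((W.quadraticTwist (((-1 : ℤ) ^ (p / 2) * p : ℤ) : ℚ)).HasGoodReductionAt
            ((Rat.HeightOneSpectrum.primesEquiv (R := ℤ)).symm ⟨p, hp⟩) ∨
          (W.quadraticTwist (((-1 : ℤ) ^ (p / 2) * p : ℤ) : ℚ)).HasMultiplicativeReductionAt
            ((Rat.HeightOneSpectrum.primesEquiv (R := ℤ)).symm ⟨p, hp⟩)) →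
      (∀ z ∈ D.L.lattice, ∃ w ∈ periodLattice D.f, z = D.c * w) → 500000 < N → False) :
    EisensteinRaynaudRegimeManinUnit := by
  intro hM hAU hC hnf W _ _ N _ D p hp hrow hpN hred htw hopt
  by_cases hN : N ≤ 500000
  · exact not_dvd_maninConstant_of_level_le_500000 hCr W D hopt hN hp
  · have hN' : 500000 < N := lt_of_not_ge hN
    rcases hrow with ⟨rfl, h5⟩ | ⟨rfl, h7⟩
    · simp only [Finset.mem_insert, Finset.mem_singleton] at h5
      rcases h5 with h5 | h5
      · exact hK15b hM hAU hC hnf W D 5 hp (Or.inl ⟨rfl, h5⟩) hpN hred htw hopt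
      · exact (hVac W D 5 hp (Or.inl ⟨rfl, h5⟩) hpN hred htw hopt hN').elim
    · simp only [Finset.mem_insert, Finset.mem_singleton] at h7
      rcases h7 with h7 | h7
      · exact hK15b hM hAU hC hnf W D 7 hp (Or.inr ⟨rfl, h7⟩) hpN hred htw hopt
      · exact (hVac W D 7 hp (Or.inr ⟨rfl, h7⟩) hpN hred htw hopt hN').elim

/-! ## §4 The engine stub and the crux from the sibling cell's orientation conjecture E-imc-5 at `5` and `7` -/

/-- **`stub_kummerFreeEngine` = S16b (stmt-27296) BY NAME ⟸ modularity ∧ E-imc-5 `OptimalUnstarredAcrossIsogeny 5` ∧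
`OptimalUnstarredAcrossIsogeny 7`** (the cell bsd-f2-manin's registered `@[conjecture]`: for `p ≥ 5` the `X₀`-optimal curve is
never the starred end of a rational `p`-isogeny facing an unstarred end). Route ManinLocalTwoThree's
`supersingularStrongIsUnstarred_of_acrossIsogeny` (K15a ⟸ modularity ∧ E-imc-5(5) ∧ E-imc-5(7); Coates' congruence
`p·v(Δ_min E) ≡ v(Δ_min E') (mod 12)`, Tate's table, no Gealy–Klagsbrun) composed with §1. CONDITIONAL on modularity and the OPEN
conjecture E-imc-5 (not in print); closes nothing. [cite: DiamondShurman2005, Thm. 8.8.1] [cite: Stevens1989, §2]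
[cite: EdixhovenManin1991, §4 (the twist table II↔IV*, III↔III*, IV↔II*)] -/
theorem supersingularKummerFreeStrongIsUnstarred_of_acrossIsogeny
    (hmod : Literature.NumberTheory.EllipticCurves.ModularForms.exists_isNewformOf)
    (hE5 : Summit.BirchSwinnertonDyer.Rank1Residual.ManinAdditive.OptimalUnstarredAcrossIsogeny 5)
    (hE7 : Summit.BirchSwinnertonDyer.Rank1Residual.ManinAdditive.OptimalUnstarredAcrossIsogeny 7) :
    SupersingularKummerFreeStrongIsUnstarred :=
  supersingularKummerFreeStrongIsUnstarred_of_supersingularStrongIsUnstarred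
    (supersingularStrongIsUnstarred_of_acrossIsogeny hmod hE5 hE7)

/-- **The crux Ray57 (stmt-26325) BY NAME ⟸ E-imc-5(5) ∧ E-imc-5(7) ∧ K15b** — the registered skeleton `kummer_free_split`
with its engine stub traded for the sibling cell's orientation conjecture: G15 `raynaudRegimeOfOrientation_proof` over
`supersingularStrongIsUnstarred_of_acrossIsogeny` (modularity is Ray57's own fourth antecedent `h₄`) and K15b. CONDITIONAL on
the OPEN conjecture E-imc-5 and the OPEN print-extension K15b (stmt-27071); closes nothing; BSD and Manin's conjecture are not
proved by this. [cite: EdixhovenManin1991, Thm. 3 and Prop. 7] [cite: Stevens1989, §2] -/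
theorem eisensteinRaynaudRegimeManinUnit_of_acrossIsogeny_of_unstarredStrongManinUnit
    (hE5 : Summit.BirchSwinnertonDyer.Rank1Residual.ManinAdditive.OptimalUnstarredAcrossIsogeny 5)
    (hE7 : Summit.BirchSwinnertonDyer.Rank1Residual.ManinAdditive.OptimalUnstarredAcrossIsogeny 7)
    (hK15b : SupersingularUnstarredStrongManinUnit) : EisensteinRaynaudRegimeManinUnit :=
  fun h₁ h₂ h₃ h₄ ↦ raynaudRegimeOfOrientation_proof
    (supersingularStrongIsUnstarred_of_acrossIsogeny h₄ hE5 hE7) hK15b h₁ h₂ h₃ h₄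

end Summit.BirchSwinnertonDyer.BirchSwinnertonDyer.Theorems.TwistFamilyManinDescent

end
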